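import Summits.BirchSwinnertonDyer.BirchSwinnertonDyer.Theorems.KolyvaginRankRigidityAtTwoRingClassNoTwoTorsion
import Summits.BirchSwinnertonDyer.BirchSwinnertonDyer.Theorems.KolyvaginRankRigidityAtTwoOffHabitatIrredNonSurjTwoConverseNoTwoTorsionOverKOfIrred
import Literature.NumberTheory.EllipticCurves.RingClassFieldConjugation
import HarnessLib

/-!
# Route `KolyvaginRankRigidityAtTwo`, residual crux R_irr `OffHabitatIrredNonSurjTwoConverse`
# (stmt-BirchSwinnertonDyer-27123, LINE 8 «margin absorbs index»): Gross 1991, Lemma 4.3 AT `p = 2`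
# OFF THE HABITAT — `E(K[n])[2] = 0` and the `hA` binder from `E(ℚ)[2] = 0` alone
# (helper, PROVED, unconditional; width seat `bsd-line-krr2-p2` g9)

The habitat file `…RingClassNoTwoTorsion` proves `E(K[n])[2] = 0` (so that the tree's Kolyvagin
class at `2` is McCallum's class and not the junk value `0`) from `ρ̄_{E,2}` ONTO `GL₂(𝔽₂) ≅ S₃`,
i.e. (Dokchitser–Dokchitser (1)) `E(ℚ)[2] = 0` AND `Δ_E ∉ ℚ^{×2}`. On the frame of R_irr
(`E(ℚ)[2] = 0`, any `2`-adic image) one case is missing: **`Δ_E ∈ ℚ^{×2}`**, i.e. `ρ̄_{E,2}(Γ_ℚ) = C₃`,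
`ℚ(E[2])` a CYCLIC CUBIC field. This file closes it by Cox's Lemma 9.3 (the tree's
`apply_apply_eq_inv_apply_of_not_mem_ringClassGal`: an automorphism `τ` of `K[n]` moving `K`
inverts `𝒢_n = Gal(K[n]/K)`): a point of order `2` over `K[n]` makes the `2`-division cubic —
irreducible over `K` since `E(K)[2] = 0` (stub `stub_noTwoTorsionOverK_of_irred`, p634161) — split
in the normal extension `K[n]/K`, with roots `e₁, e₂, e₃`; as `Δ_E = r²`, the alternant
`δ = (e₁-e₂)(e₁-e₃)(e₂-e₃) = ±r/4` is RATIONAL, so every automorphism of `K[n]` permutes the roots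
EVENLY (identity or a `3`-cycle); the `3`-cycles commute, so `τστ⁻¹ = σ⁻¹` read on the roots gives
`σ² = 1`, i.e. every `σ ∈ 𝒢_n` FIXES the roots; by Galois theory the roots lie in `K` —
contradicting irreducibility over `K`. Results:

* `twoTorsion_eq_zero_ringClassField_of_isSquare` — `E(K[n])[2] = 0` for `E(K)[2] = 0`,
  `Δ_E ∈ ℚ^{×2}`, `K` imaginary quadratic, ANY `n ≠ 0` (no Heegner hypothesis needed in this case);
* `twoTorsion_eq_zero_ringClassField_offHabitat` — **`E(K[n])[2] = 0` on the whole frame of R_irr**: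
  `E(ℚ)[2] = 0` (globally minimal `W`), `K` imaginary quadratic with `d_K` odd and the Heegner
  hypothesis, `n ≠ 0` odd and prime to `N_E` (the case `Δ ∉ ℚ^{×2}` is the habitat theorem
  `twoTorsion_eq_zero_ringClassField_of_heegner`, whose only image input is `ρ̄_{E,2}` onto);
* `torsionBy_two_pow_ringClassField_eq_bot_offHabitat`, `eq_zero_of_zsmul_two_pow_eq_zero_ringClassField_offHabitat`,
  `isAdmissible_pointsSubgroup_two_offHabitat` — `E(K[n])[2^M] = 0` and the `hA` binder of
  `KolyvaginHeegnerData.kolyvaginClass` at `p = 2` off the habitat.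

HONEST FRAMING: helper lemmas (`--supports` 27123); nothing here closes R_irr, U1 28083 or the print
item 23091; BSD is NOT proved by any of this.

References: [GrossLMS1991] §4 Lemma 4.3; [McCallumLMS1991] §4 (5); [Cox2013] §9.A Lemma 9.3;
[DokchitserDokchitserMathZ2012] Theorem (1); [SilvermanAEC2009] III.§1.
-/

set_option autoImplicit false
-- the Theorems namespace of this sub repeats the summit name by design (D-0017 nested layout)
set_option linter.dupNamespace false

noncomputable section

open scoped Classical

namespace Summit.BirchSwinnertonDyer.BirchSwinnertonDyer.Theorems.KolyvaginRankRigidity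

open NumberField IsDedekindDomain Field WeierstrassCurve Polynomial
open Literature.NumberTheory.EllipticCurves Literature.NumberTheory.GaloisRepresentations
open Summit.BirchSwinnertonDyer.Rank1Residual.X11b

variable {K : Type} [Field K] [NumberField K]

/-! ## §1 The `2`-division cubic under base change -/

/-- The `2`-division cubic commutes with base change, as a polynomial (a copy of the tree's private
`twoTorsionCubic_toPoly_baseChange`). [folklore] -/
theorem twoTorsionCubic_toPoly_baseChange_rat (W : WeierstrassCurve ℚ) {L : Type*} [Field L]
    [CharZero L] :
    (W.baseChange L).twoTorsionPolynomial.toPoly =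
      W.twoTorsionPolynomial.toPoly.map (algebraMap ℚ L) := by
  rw [← Cubic.map_toPoly]
  congr 1
  simp [baseChange, twoTorsionPolynomial, Cubic.map, map_b₂, map_b₄, map_b₆, map_ofNat]

/-! ## §2 The cyclic-cubic case: `Δ_E ∈ ℚ^{×2}` -/

set_option maxHeartbeats 1600000 in
/-- **Gross 1991, Lemma 4.3 at `p = 2`, cyclic-cubic case.** Let `W/ℚ` be elliptic with
`E(K)[2] = 0` over the imaginary quadratic field `K` and `Δ_E` a rational square (so `ℚ(E[2])` is
a cyclic cubic field), `ι : K → ℂ`, `n ≠ 0`. Then `E(K[n])[2] = 0`: every `P ∈ E(K[n])` with `2P = O`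
is `O`. (Cox Lemma 9.3: automorphisms of `K[n]` outside `𝒢_n` invert `𝒢_n`; all automorphisms
permute the roots of the `2`-division cubic evenly because its alternant is rational; hence
`𝒢_n` fixes the roots, which then lie in `K`.) [cite: GrossLMS1991, §4 Lemma 4.3]
[cite: Cox2013, §9.A Lemma 9.3] [cite: DokchitserDokchitserMathZ2012, Theorem (1), proof] -/
theorem twoTorsion_eq_zero_ringClassField_of_isSquare (W : WeierstrassCurve ℚ) [W.IsElliptic]
    (hnoK : ∀ Q : (W.baseChange K).toAffine.Point, 2 • Q = 0 → Q = 0) (hsq : IsSquare W.Δ)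
    (hK : IsImaginaryQuadratic K) (ι : K →+* ℂ) {n : ℕ} (hn : n ≠ 0)
    (P : (W.baseChange (ringClassField K ι n)).toAffine.Point) (hP : 2 • P = 0) : P = 0 := by
  haveI := (finiteDimensional_and_isGalois_ringClassField hK ι hn).1
  haveI := (finiteDimensional_and_isGalois_ringClassField hK ι hn).2
  haveI : IsScalarTower ℚ K (ringClassField K ι n) :=
    IsScalarTower.of_algebraMap_eq' (RingHom.ext_rat _ _).symm
  haveI : (W.baseChange K).IsElliptic := by rw [baseChange]; infer_instance
  by_contra hP0
  rcases P with _ | ⟨x, y, h⟩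
  · exact hP0 rfl
  -- the abscissa `x` is a root of the cubic over `K[n]`
  have hP2 : Affine.Point.some x y h + Affine.Point.some x y h = 0 := by rwa [two_nsmul] at hP
  -- (`convert` bridges the two `DecidableEq` instances behind the group law on `E(K[n])`)
  have hrootL : (W.baseChange (ringClassField K ι n)).twoTorsionPolynomial.toPoly.IsRoot x :=
    ((W.baseChange (ringClassField K ι n)).isRoot_twoTorsionPolynomial_of_add_self_eq_zero
      (x := x) (y := y) (h := h) (by convert hP2)).2
  have hcomp : (algebraMap K (ringClassField K ι n)).comp (algebraMap ℚ K) =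
      algebraMap ℚ (ringClassField K ι n) := RingHom.ext_rat _ _
  have hfK : (W.baseChange K).twoTorsionPolynomial.toPoly =
      W.twoTorsionPolynomial.toPoly.map (algebraMap ℚ K) := twoTorsionCubic_toPoly_baseChange_rat W
  have hfL : (W.baseChange (ringClassField K ι n)).twoTorsionPolynomial.toPoly =
      ((W.baseChange K).twoTorsionPolynomial.toPoly).map (algebraMap K (ringClassField K ι n)) := by
    rw [hfK, Polynomial.map_map, hcomp]
    exact twoTorsionCubic_toPoly_baseChange_rat W
  have hrootQ : (W.twoTorsionPolynomial.toPoly.map (algebraMap ℚ (ringClassField K ι n))).IsRoot x := by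
    rw [← twoTorsionCubic_toPoly_baseChange_rat W]; exact hrootL
  rw [hfL] at hrootL
  -- the cubic is irreducible over `K` (no `K`-rational `2`-torsion) and splits in the normal `K[n]`
  have hirr : Irreducible (W.baseChange K).twoTorsionPolynomial.toPoly :=
    (W.baseChange K).irreducible_twoTorsionPolynomial_of_forall_two_nsmul two_ne_zero hnoK
  have haeval : aeval x (W.baseChange K).twoTorsionPolynomial.toPoly = 0 := by
    rwa [aeval_def, ← eval_map]
  have hmin := minpoly.eq_of_irreducible hirr haeval
  have hlc : (W.baseChange K).twoTorsionPolynomial.toPoly.leadingCoeff ≠ 0 :=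
    leadingCoeff_ne_zero.mpr hirr.ne_zero
  have hsplitMin : ((minpoly K x).map (algebraMap K (ringClassField K ι n))).Splits :=
    Normal.splits inferInstance x
  have hsplit : (((W.baseChange K).twoTorsionPolynomial.toPoly).map
      (algebraMap K (ringClassField K ι n))).Splits := by
    rw [← hmin, Polynomial.map_mul, Polynomial.map_C] at hsplitMin
    exact (splits_mul_iff_left (C_ne_zero.mpr (by simpa using hlc)) (Splits.C _)).mp hsplitMin
  have ha : W.twoTorsionPolynomial.a ≠ 0 := by change (4 : ℚ) ≠ 0; norm_num
  have hsplit' : (W.twoTorsionPolynomial.toPoly.map (algebraMap ℚ (ringClassField K ι n))).Splits := by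
    rwa [hfK, Polynomial.map_map, hcomp] at hsplit
  obtain ⟨e₁, e₂, e₃, h3⟩ := (Cubic.splits_iff_roots_eq_three ha).mp hsplit'
  -- the three roots are distinct (`disc = 16 Δ ≠ 0`)
  have hΔ0 : W.Δ ≠ 0 := by rw [← coe_Δ']; exact W.Δ'.ne_zero
  have hdisc0 : W.twoTorsionPolynomial.discr ≠ 0 := by
    rw [twoTorsionPolynomial_discr]; exact mul_ne_zero (by norm_num) hΔ0
  obtain ⟨h12, h13, h23⟩ := (Cubic.discr_ne_zero_iff_roots_ne ha h3).mp hdisc0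
  have hδ0 : (e₁ - e₂) * (e₁ - e₃) * (e₂ - e₃) ≠ 0 :=
    mul_ne_zero (mul_ne_zero (sub_ne_zero.mpr h12) (sub_ne_zero.mpr h13)) (sub_ne_zero.mpr h23)
  -- the roots of the cubic in `K[n]` are exactly `e₁, e₂, e₃`
  have hne : W.twoTorsionPolynomial.toPoly.map (algebraMap ℚ (ringClassField K ι n)) ≠ 0 :=
    (Polynomial.map_ne_zero_iff (algebraMap ℚ (ringClassField K ι n)).injective).mpr
      (Cubic.ne_zero_of_a_ne_zero ha)
  have hroots : (W.twoTorsionPolynomial.toPoly.map (algebraMap ℚ (ringClassField K ι n))).roots =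
      {e₁, e₂, e₃} := by
    rw [← Cubic.map_toPoly]; exact h3
  have hrootiff : ∀ z : ringClassField K ι n,
      (W.twoTorsionPolynomial.toPoly.map (algebraMap ℚ (ringClassField K ι n))).IsRoot z ↔
        (z = e₁ ∨ z = e₂ ∨ z = e₃) := by
    intro z
    rw [← mem_roots hne, hroots]
    simp only [Multiset.insert_eq_cons, Multiset.mem_cons, Multiset.mem_singleton]
  -- every automorphism of `K[n]` permutes the roots …
  have hperm : ∀ (g : ringClassField K ι n ≃ₐ[ℚ] ringClassField K ι n) (z : ringClassField K ι n),
      (z = e₁ ∨ z = e₂ ∨ z = e₃) → (g z = e₁ ∨ g z = e₂ ∨ g z = e₃) := by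
    intro g z hz
    rw [← hrootiff] at hz ⊢
    rw [IsRoot.def, eval_map, ← aeval_def] at hz ⊢
    rw [show g z = (g : ringClassField K ι n →ₐ[ℚ] ringClassField K ι n) z from rfl,
      aeval_algHom_apply, hz, map_zero]
  -- … and fixes the alternant `δ = (e₁-e₂)(e₁-e₃)(e₂-e₃) = ±r/4 ∈ ℚ` (`Δ = r²`, `16Δ = disc = (16δ)²`)
  obtain ⟨r, hr⟩ := hsq
  have hdisc := Cubic.discr_eq_prod_three_roots ha h3
  have hsq' : (4 * ((e₁ - e₂) * (e₁ - e₃) * (e₂ - e₃))) ^ 2 =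
      (algebraMap ℚ (ringClassField K ι n) r) ^ 2 := by
    have ha4 : W.twoTorsionPolynomial.a = 4 := rfl
    rw [twoTorsionPolynomial_discr, ha4, map_mul, map_ofNat, hr, map_mul, map_ofNat] at hdisc
    have h16 : (16 : ringClassField K ι n) ≠ 0 := by norm_num
    apply mul_left_cancel₀ h16
    linear_combination -hdisc
  have hfix : ∀ g : ringClassField K ι n ≃ₐ[ℚ] ringClassField K ι n,
      g ((e₁ - e₂) * (e₁ - e₃) * (e₂ - e₃)) = (e₁ - e₂) * (e₁ - e₃) * (e₂ - e₃) := by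
    intro g
    have h4 : g (4 * ((e₁ - e₂) * (e₁ - e₃) * (e₂ - e₃))) =
        4 * ((e₁ - e₂) * (e₁ - e₃) * (e₂ - e₃)) := by
      rcases eq_or_eq_neg_of_sq_eq_sq _ _ hsq' with h' | h'
      · rw [h', AlgEquiv.commutes]
      · rw [h', map_neg, AlgEquiv.commutes]
    rw [map_mul, map_ofNat] at h4
    exact mul_left_cancel₀ (by norm_num : (4 : ringClassField K ι n) ≠ 0) h4
  -- hence permutes the roots EVENLY: identity or one of the two `3`-cycles
  have heven : ∀ g : ringClassField K ι n ≃ₐ[ℚ] ringClassField K ι n,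
      (g e₁ = e₁ ∧ g e₂ = e₂ ∧ g e₃ = e₃) ∨ (g e₁ = e₂ ∧ g e₂ = e₃ ∧ g e₃ = e₁) ∨
        (g e₁ = e₃ ∧ g e₂ = e₁ ∧ g e₃ = e₂) := by
    intro g
    have hinj : Function.Injective g := g.injective
    have hδg := hfix g
    rw [map_mul, map_mul, map_sub, map_sub, map_sub] at hδg
    have two_ne : (2 : ringClassField K ι n) ≠ 0 := two_ne_zero
    rcases hperm g e₁ (Or.inl rfl) with h1 | h1 | h1 <;>
    rcases hperm g e₂ (Or.inr (Or.inl rfl)) with h2 | h2 | h2 <;>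
    rcases hperm g e₃ (Or.inr (Or.inr rfl)) with h3' | h3' | h3' <;>
    first
    | exact absurd (hinj (h1.trans h2.symm)) h12
    | exact absurd (hinj (h1.trans h3'.symm)) h13
    | exact absurd (hinj (h2.trans h3'.symm)) h23
    | exact Or.inl ⟨h1, h2, h3'⟩
    | exact Or.inr (Or.inl ⟨h1, h2, h3'⟩)
    | exact Or.inr (Or.inr ⟨h1, h2, h3'⟩)
    | (exfalso
       rw [h1, h2, h3'] at hδg
       have h2δ : (2 : ringClassField K ι n) * ((e₁ - e₂) * (e₁ - e₃) * (e₂ - e₃)) = 0 := by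
         linear_combination -hδg
       exact hδ0 ((mul_eq_zero.mp h2δ).resolve_left two_ne))
  -- Cox Lemma 9.3: an automorphism `τ ∉ 𝒢_n` inverts `𝒢_n`; with evenness, `𝒢_n` fixes the roots
  obtain ⟨τ, hτ, -⟩ := exists_not_mem_ringClassGal_forall_mul_mul_inv_eq_inv hK ι hn
  have hinv_apply : ∀ (σ : ringClassField K ι n ≃ₐ[ℚ] ringClassField K ι n)
      {a b : ringClassField K ι n}, σ a = b → σ⁻¹ b = a := fun σ {a b} hab ↦ by
    rw [AlgEquiv.aut_inv, ← hab, AlgEquiv.symm_apply_apply]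
  have hfixroots : ∀ σ ∈ ringClassGal ι n, σ e₁ = e₁ ∧ σ e₂ = e₂ ∧ σ e₃ = e₃ := by
    intro σ hσ
    have hrel : ∀ z, τ (σ z) = σ⁻¹ (τ z) :=
      apply_apply_eq_inv_apply_of_not_mem_ringClassGal hK ι hn hτ hσ
    have hr1 := hrel e₁
    rcases heven σ with hσ' | ⟨s1, s2, s3⟩ | ⟨s1, s2, s3⟩
    · exact hσ'
    · exfalso
      rw [s1] at hr1
      rcases heven τ with ⟨t1, t2, -⟩ | ⟨t1, t2, -⟩ | ⟨t1, t2, -⟩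
      · rw [t2, t1, hinv_apply σ s3] at hr1; exact h23 hr1
      · rw [t2, t1, hinv_apply σ s1] at hr1; exact h13 hr1.symm
      · rw [t2, t1, hinv_apply σ s2] at hr1; exact h12 hr1
    · exfalso
      rw [s1] at hr1
      rcases heven τ with ⟨t1, -, t3⟩ | ⟨t1, -, t3⟩ | ⟨t1, -, t3⟩
      · rw [t3, t1, hinv_apply σ s2] at hr1; exact h23 hr1.symm
      · rw [t3, t1, hinv_apply σ s3] at hr1; exact h13 hr1
      · rw [t3, t1, hinv_apply σ s1] at hr1; exact h12 hr1.symm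
  -- so `x ∈ {e₁, e₂, e₃}` is fixed by `Gal(K[n]/K)`, hence lies in `K`
  have hxroot : x = e₁ ∨ x = e₂ ∨ x = e₃ := (hrootiff x).mp hrootQ
  have hxfix : ∀ σ ∈ ringClassGal ι n, σ x = x := by
    intro σ hσ
    obtain ⟨f1, f2, f3⟩ := hfixroots σ hσ
    rcases hxroot with rfl | rfl | rfl
    exacts [f1, f2, f3]
  have hxK : x ∈ Set.range (algebraMap K (ringClassField K ι n)) := by
    refine (IsGalois.mem_range_algebraMap_iff_fixed x).mpr fun ψ ↦ ?_
    have hmem : ψ.restrictScalars ℚ ∈ ringClassGal ι n :=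
      (mem_ringClassGal_iff_forall_apply_algebraMap ι n _).mpr fun k ↦ ψ.commutes k
    exact hxfix _ hmem
  obtain ⟨k, hk⟩ := hxK
  -- a `K`-rational root of a cubic irreducible over `K`: contradiction
  have hkroot : (W.baseChange K).twoTorsionPolynomial.toPoly.IsRoot k := by
    have h0 : algebraMap K (ringClassField K ι n) (aeval k (W.baseChange K).twoTorsionPolynomial.toPoly)
        = 0 := by
      rw [← aeval_algebraMap_apply, hk, haeval]
    have h1 : aeval k (W.baseChange K).twoTorsionPolynomial.toPoly = 0 :=
      (algebraMap K (ringClassField K ι n)).injective (by rw [h0, map_zero])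
    rwa [coe_aeval_eq_eval] at h1
  have hdeg := degree_eq_one_of_irreducible_of_root hirr hkroot
  have hnat : (W.baseChange K).twoTorsionPolynomial.toPoly.natDegree = 3 :=
    (W.baseChange K).natDegree_twoTorsionPolynomial two_ne_zero
  have : (W.baseChange K).twoTorsionPolynomial.toPoly.natDegree = 1 := natDegree_eq_of_degree_eq_some hdeg
  omega

/-! ## §3 `E(K[n])[2] = 0` on the whole frame of R_irr -/

/-- **Gross 1991, Lemma 4.3 AT `p = 2` OFF THE HABITAT: `E(K[n])[2] = 0` from `E(ℚ)[2] = 0` alone.**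
Let `W/ℚ` be globally minimal elliptic with `E(ℚ)[2] = 0` (no surjectivity of `ρ̄_{E,2}`: image
`C₃` or `S₃`, any `2`-adic index), `K` imaginary quadratic with `d_K` odd and the Heegner hypothesis
for `N_E`, `ι : K → ℂ`, `n ≠ 0` odd and prime to `N_E`. Then every `P ∈ E(K[n])` with `2P = O` is
`O`. (`Δ ∉ ℚ^{×2}`: `ρ̄_{E,2}` is onto and the habitat theorem applies; `Δ ∈ ℚ^{×2}`: §2.)
[cite: GrossLMS1991, §4 Lemma 4.3] [cite: DokchitserDokchitserMathZ2012, Theorem (1)]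
[cite: Cox2013, §9.A] -/
theorem twoTorsion_eq_zero_ringClassField_offHabitat (W : WeierstrassCurve ℚ) [W.IsElliptic]
    [W.IsGloballyMinimal] (htorQ : AddSubgroup.torsionBy W.toAffine.Point (2 : ℤ) = ⊥)
    (hK : IsImaginaryQuadratic K) (ι : K →+* ℂ) (hodd : ¬ (2 : ℤ) ∣ NumberField.discr K)
    (hH : SatisfiesHeegnerHypothesis (W.conductorNorm ℤ) K) {n : ℕ} (hn : n ≠ 0) (h2n : ¬ 2 ∣ n)
    (hNn : Nat.Coprime (W.conductorNorm ℤ) n)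
    (P : (W.baseChange (ringClassField K ι n)).toAffine.Point) (hP : 2 • P = 0) : P = 0 := by
  have hnoQ : ∀ Q : W.toAffine.Point, 2 • Q = 0 → Q = 0 := by
    have h := (torsionBy_two_eq_bot_iff_forall_two_nsmul).mp htorQ
    exact fun Q hQ ↦ h Q (by convert hQ)
  by_cases hsq : IsSquare W.Δ
  · have hnoK : ∀ Q : (W.baseChange K).toAffine.Point, 2 • Q = 0 → Q = 0 :=
      (torsionBy_two_eq_bot_iff_forall_two_nsmul).mp (stub_noTwoTorsionOverK_of_irred W htorQ K hK)
    exact twoTorsion_eq_zero_ringClassField_of_isSquare W hnoK hsq hK ι hn P hP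
  · have hs : W.HasSurjectiveModNGaloisRep 2 :=
      (hasSurjectiveModNGaloisRep_two_iff W).mpr ⟨fun Q hQ ↦ hnoQ Q (by convert hQ), hsq⟩
    exact twoTorsion_eq_zero_ringClassField_of_heegner W hs hK ι hodd hH hn h2n hNn P hP

/-- **`E(K[n])[2^M] = 0` off the habitat** (McCallum 1991 §4 (5) at `p = 2` from `E(ℚ)[2] = 0`).
[cite: McCallumLMS1991, §4 (5)] [cite: GrossLMS1991, §4 Lemma 4.3] -/
theorem torsionBy_two_pow_ringClassField_eq_bot_offHabitat (W : WeierstrassCurve ℚ) [W.IsElliptic]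
    [W.IsGloballyMinimal] (htorQ : AddSubgroup.torsionBy W.toAffine.Point (2 : ℤ) = ⊥)
    (hK : IsImaginaryQuadratic K) (ι : K →+* ℂ) (hodd : ¬ (2 : ℤ) ∣ NumberField.discr K)
    (hH : SatisfiesHeegnerHypothesis (W.conductorNorm ℤ) K) {n : ℕ} (hn : n ≠ 0) (h2n : ¬ 2 ∣ n)
    (hNn : Nat.Coprime (W.conductorNorm ℤ) n) (M : ℕ) :
    AddSubgroup.torsionBy (W.baseChange (ringClassField K ι n)).toAffine.Point ((2 ^ M : ℕ) : ℤ) =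
      ⊥ := by
  refine torsionBy_pow_eq_bot (p := 2) ?_ M
  rw [eq_bot_iff]
  intro P hP
  rw [AddSubgroup.mem_bot]
  exact twoTorsion_eq_zero_ringClassField_offHabitat W htorQ hK ι hodd hH hn h2n hNn P
    (by rw [← natCast_zsmul, Nat.cast_ofNat]; exact (Submodule.mem_torsionBy_iff (2 : ℤ) P).mp hP)

/-- **`E(K[n])` has no `2^M`-torsion off the habitat, element form** (`2^M • R = 0 ⇒ R = 0`; the
`htor` hypothesis of `Koly.pDiv_one_iff_exists_zsmul_eq` at `p = 2`). [cite: McCallumLMS1991, §4 (5)] -/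
theorem eq_zero_of_zsmul_two_pow_eq_zero_ringClassField_offHabitat (W : WeierstrassCurve ℚ)
    [W.IsElliptic] [W.IsGloballyMinimal] (htorQ : AddSubgroup.torsionBy W.toAffine.Point (2 : ℤ) = ⊥)
    (hK : IsImaginaryQuadratic K) (ι : K →+* ℂ) (hodd : ¬ (2 : ℤ) ∣ NumberField.discr K)
    (hH : SatisfiesHeegnerHypothesis (W.conductorNorm ℤ) K) {n : ℕ} (hn : n ≠ 0) (h2n : ¬ 2 ∣ n)
    (hNn : Nat.Coprime (W.conductorNorm ℤ) n) (M : ℕ)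
    (R : (W.baseChange (ringClassField K ι n)).toAffine.Point) (hR : ((2 ^ M : ℕ) : ℤ) • R = 0) :
    R = 0 := by
  have h : R ∈ AddSubgroup.torsionBy (W.baseChange (ringClassField K ι n)).toAffine.Point
      ((2 ^ M : ℕ) : ℤ) := (Submodule.mem_torsionBy_iff ((2 ^ M : ℕ) : ℤ) R).mpr hR
  rwa [torsionBy_two_pow_ringClassField_eq_bot_offHabitat W htorQ hK ι hodd hH hn h2n hNn M,
    AddSubgroup.mem_bot] at h

/-! ## §4 The `hA` binder of McCallum's cocycle at `p = 2` off the habitat -/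

section KolyvaginHeegnerData

open Literature.NumberTheory.EllipticCurves.ModularForms

variable {N : ℕ} [NeZero N] {W : WeierstrassCurve ℚ} {Dt : ModularParametrizationData W N} {β : ℤ}
  {ι : K →+* ℂ} {n : ℕ} (d : KolyvaginHeegnerData Dt β ι n)

/-- **The `hA` binder of `KolyvaginHeegnerData.kolyvaginClass` AT `p = 2` OFF THE HABITAT**:
for `W/ℚ` globally minimal elliptic with `E(ℚ)[2] = 0` (any `2`-adic image), `K` imaginary
quadratic with `d_K` odd and the Heegner hypothesis for `N_E`, and a concrete Kolyvagin–Heegner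
datum `d` at a level `n ≠ 0` odd and prime to `N_E`, the subgroup `E(K[n]) ⊆ E(K̄)` is `Γ_K`-stable
and `2^M`-torsion-free — so `d.kolyvaginClass _ M` at `p = 2` is McCallum's class on the frame of
R_irr, not the junk value. [cite: McCallumLMS1991, §4 (5)] [cite: GrossLMS1991, §4 Lemma 4.3 and (4.2)] -/
theorem isAdmissible_pointsSubgroup_two_offHabitat [W.IsElliptic] [W.IsGloballyMinimal]
    (htorQ : AddSubgroup.torsionBy W.toAffine.Point (2 : ℤ) = ⊥) (hK : IsImaginaryQuadratic K)
    (hodd : ¬ (2 : ℤ) ∣ NumberField.discr K)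
    (hH : SatisfiesHeegnerHypothesis (W.conductorNorm ℤ) K) (hn : n ≠ 0) (h2n : ¬ 2 ∣ n)
    (hNn : Nat.Coprime (W.conductorNorm ℤ) n) (M : ℕ) :
    KolyvaginCocycle.IsAdmissible (absoluteGaloisGroup K) d.pointsSubgroup ((2 ^ M : ℕ) : ℤ) where
  smul_mem g := by
    rintro _ ⟨P, rfl⟩
    exact ⟨_, (RingClassNoTorsion.smul_toGeomPoints_eq d hK hn g P).symm⟩
  eq_zero_of_zsmul := by
    rintro _ ⟨P, rfl⟩ hP
    rw [← map_zsmul] at hP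
    have hP0 : ((2 ^ M : ℕ) : ℤ) • P = 0 :=
      (Affine.Point.map_injective (W' := W) d.emb.toRatAlgHom) (by rw [map_zero]; exact hP)
    rw [eq_zero_of_zsmul_two_pow_eq_zero_ringClassField_offHabitat W htorQ hK ι hodd hH hn h2n hNn M
      P hP0, map_zero]

end KolyvaginHeegnerData

end Summit.BirchSwinnertonDyer.BirchSwinnertonDyer.Theorems.KolyvaginRankRigidity

end
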